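import Summits.BirchSwinnertonDyer.BirchSwinnertonDyer.Theorems.ResidualThetaTransportAtTwoThetaLayerLambdaCongruenceAtTwoStarGalois
import Summits.BirchSwinnertonDyer.BirchSwinnertonDyer.Theorems.ResidualThetaTransportAtTwoThetaLayerLambdaCongruenceAtTwoSocleOfCosocle
import HarnessLib

noncomputable section
-- justification: the `Summit.BirchSwinnertonDyer.BirchSwinnertonDyer.…` path repeats a component (route-file convention)
set_option linter.dupNamespace false
open scoped MatrixGroups ModularForm NumberField Pointwise Classical
open CongruenceSubgroup Polynomial IsDedekindDomain Field Matrix WeierstrassCurve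
open Literature.NumberTheory.EllipticCurves Literature.NumberTheory.EllipticCurves.ModularForms
open Literature.NumberTheory.EllipticCurves.Rank1Residual Literature.NumberTheory.GaloisRepresentations Rat.HeightOneSpectrum
namespace Summit.BirchSwinnertonDyer.BirchSwinnertonDyer.Theorems.ThetaLayerLambdaCongruenceAtTwo

set_option linter.unusedTactic false in
set_option linter.unreachableTactic false in
set_option linter.unusedVariables false in
/-- (TYPING-ROBUST twin of `finrank_torsionBySet_eq_two_of_facts`, one extra binder `hSD`.) **`dim_{𝕋/𝔪} J₀(L)[𝔪] = 2` at a mod-`2`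
eigen-ideal of a good-supersingular-at-`2` curve from {SD, Bz, Se}**, proved so that it elaborates under EITHER coordinate of the ONE vendored
Buzzard fact (sub form today: first branch, `hSD` idle; cosocle/Picard form after a re-typing: second branch through
`finrank_torsionBySet_eq_two_of_cosocle_of_sd`, p650638). Hypotheses (U)(I)(S) discharged exactly as in the sibling. Callers (all hold `hSD`):
`kTwo_of_dvd_of_threeFacts`, `card_eigenChar_le_four_of_facts`, `kTwo_of_dvd_of_facts` — one extra token each.
[cite: Buzzard2000LevelLoweringModTwo, Prop. 2.4 and Def. 2.1–2.2 (p. 100–101)] [cite: Serre1972, §1.11 Prop. 12]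
[cite: DarmonDiamondTaylor1995, §1.6 Lemma 1.38 and §4.5 Thm. 4.26] -/
theorem finrank_torsionBySet_eq_two_of_sd_facts_GOSIM
    (hSD : heckeSelfDual_torsionBy_J0)
    (hBz : ∀ (N : ℕ) [NeZero N], Odd N →
      ∀ (𝔪 : Ideal (HeckeRing0 N 2)), 𝔪.IsMaximal → (2 : HeckeRing0 N 2) ∈ 𝔪 →
      ∀ (k : Type) [Field k] [IsAlgClosed k] [TopologicalSpace k] [DiscreteTopology k]
        (ι : HeckeRing0 N 2 ⧸ 𝔪 →+* k) (ρ : ModPGaloisRep ℚ k 2),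
        (∀ v : HeightOneSpectrum (𝓞 ℚ), ¬ ((primesEquiv v : Nat.Primes) : ℕ) ∣ 2 * N →
          ρ.IsUnramifiedAt v ∧
            ρ.HasFrobCharpolyAt v
              (X ^ 2
                - C (ι (Ideal.Quotient.mk 𝔪 (HeckeRing0.T N 2
                    ((primesEquiv v : Nat.Primes) : ℕ) (primesEquiv v : Nat.Primes).2))) * X
                + C (((primesEquiv v : Nat.Primes) : ℕ) : k))) →
        FramedRep.IsIrreducible ρ →
        (∀ v : HeightOneSpectrum (𝓞 ℚ), ((primesEquiv v : Nat.Primes) : ℕ) = 2 →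
          ∀ 𝔓 ∈ v.primesAbove, ∃ σ ∈ 𝔓.decompositionSubgroup (Field.absoluteGaloisGroup ℚ),
            ∀ c : k, ((ρ σ : GL (Fin 2) k) : Matrix (Fin 2) (Fin 2) k) ≠ Matrix.scalar (Fin 2) c) →
        Module.finrank (HeckeRing0 N 2 ⧸ 𝔪)
          (periodHomologyHecke N ⧸ (𝔪 • ⊤ : Submodule (HeckeRing0 N 2) (periodHomologyHecke N))) = 2)
    (hSe : serre1972_supersingular_decompositionSubgroup_image)
    (W : WeierstrassCurve ℚ) [W.IsElliptic] [W.IsGloballyMinimal] (hss : GoodSS W 2)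
    (L : ℕ) [NeZero L] (hL : Odd L)
    (hgood : ∀ v : HeightOneSpectrum (𝓞 ℚ), ¬ ((primesEquiv v : ℕ) ∣ 2 * L) → W.HasGoodReductionAt v)
    (𝔪 : Ideal (HeckeRing0 L 2)) (h𝔪 : 𝔪.IsMaximal) (h2 : (2 : HeckeRing0 L 2) ∈ 𝔪)
    (hq : Nat.card (HeckeRing0 L 2 ⧸ 𝔪) = 2)
    (hT : ∀ (q : ℕ) (hq : q.Prime), ¬ q ∣ L → HeckeRing0.T L 2 q hq - (W.LFunction q : HeckeRing0 L 2) ∈ 𝔪) :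
    Module.finrank (HeckeRing0 L 2 ⧸ 𝔪) (Submodule.torsionBySet (HeckeRing0 L 2) (J0 L) 𝔪) = 2 := by
  classical
  -- the coefficient field `k = 𝔽̄₂` (discrete) and `ι : 𝕋/𝔪 ≅ 𝔽₂ → k`
  let k : Type := AlgebraicClosure (ZMod 2)
  letI : TopologicalSpace k := ⊥
  haveI : DiscreteTopology k := ⟨rfl⟩
  haveI : Finite (HeckeRing0 L 2 ⧸ 𝔪) := Nat.finite_of_card_ne_zero (by rw [hq]; norm_num)
  letI : Fintype (HeckeRing0 L 2 ⧸ 𝔪) := Fintype.ofFinite _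
  have hF : Fintype.card (HeckeRing0 L 2 ⧸ 𝔪) = 2 := by rw [Fintype.card_eq_nat_card, hq]
  let e : ZMod 2 ≃+* HeckeRing0 L 2 ⧸ 𝔪 := ZMod.ringEquivOfPrime _ Nat.prime_two hF
  let f : ZMod 2 →+* k := algebraMap (ZMod 2) k
  let ι : HeckeRing0 L 2 ⧸ 𝔪 →+* k := f.comp e.symm.toRingHom
  have hι : ∀ a : ℤ, ι (Ideal.Quotient.mk 𝔪 (a : HeckeRing0 L 2)) = (a : k) := fun a ↦ by
    simp only [map_intCast]
  -- the mod-`2` representation of `W` and its base change to `k`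
  obtain ⟨ρ₀, hρ₀⟩ := W.exists_isTorsionGaloisRep 2
  let ρ : ModPGaloisRep ℚ k 2 := FramedRep.baseChange f continuous_of_discreteTopology ρ₀
  have hρapp : ∀ σ, ((ρ σ : GL (Fin 2) k) : Matrix (Fin 2) (Fin 2) k) =
      ((ρ₀ σ : GL (Fin 2) (ZMod 2)) : Matrix (Fin 2) (Fin 2) (ZMod 2)).map f := fun σ ↦ rfl
  -- every element of `GL₂(𝔽₂)` is a `ρ̄(σ)`, `σ ∈ D_𝔓`, for `𝔓 ∣ 2`
  have hmem : ∀ v : HeightOneSpectrum (𝓞 ℚ), ((primesEquiv v : Nat.Primes) : ℕ) = 2 → ∀ 𝔓 ∈ v.primesAbove,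
      ∀ g : GL (Fin 2) (ZMod 2), ∃ σ ∈ 𝔓.decompositionSubgroup (absoluteGaloisGroup ℚ), ρ₀ σ = g := by
    intro v hv 𝔓 h𝔓 g
    have hg : g ∈ (𝔓.decompositionSubgroup (absoluteGaloisGroup ℚ)).map ρ₀.toMonoidHom := by
      rw [map_decompositionSubgroup_eq_top_of_goodSS_two hSe W hss hρ₀ hv h𝔓]; exact Subgroup.mem_top g
    obtain ⟨σ, hσ, hσg⟩ := Subgroup.mem_map.mp hg
    exact ⟨σ, hσ, hσg⟩
  -- (U) unramified with the Eichler–Shimura characteristic polynomial at `p ∤ 2L`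
  have hU : ∀ v : HeightOneSpectrum (𝓞 ℚ), ¬ ((primesEquiv v : Nat.Primes) : ℕ) ∣ 2 * L →
      ρ.IsUnramifiedAt v ∧
        ρ.HasFrobCharpolyAt v
          (X ^ 2
            - C (ι (Ideal.Quotient.mk 𝔪 (HeckeRing0.T L 2
                ((primesEquiv v : Nat.Primes) : ℕ) (primesEquiv v : Nat.Primes).2))) * X
            + C (((primesEquiv v : Nat.Primes) : ℕ) : k)) := by
    intro v hv
    have hp2 : ¬ ((primesEquiv v : Nat.Primes) : ℕ) ∣ 2 := fun h ↦ hv (h.mul_right L)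
    have hpL : ¬ ((primesEquiv v : Nat.Primes) : ℕ) ∣ L := fun h ↦ hv (Dvd.dvd.mul_left h 2)
    have hgoodv : W.HasGoodReductionAt v := hgood v hv
    have h2v : ((2 : ℕ) : 𝓞 ℚ) ∉ v.asIdeal := fun h ↦ hp2 ((natCast_mem_asIdeal_iff_primesEquiv_dvd v 2).mp h)
    refine ⟨?_, ?_⟩
    · intro 𝔓 h𝔓 σ hσ
      have h1 : ρ₀ σ = 1 := hρ₀.isUnramifiedAt_of_hasGoodReductionAt hgoodv h2v 𝔓 h𝔓 σ hσ
      change Matrix.GeneralLinearGroup.map f (ρ₀ σ) = 1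
      rw [h1, map_one]
    · intro 𝔓 h𝔓 σ hσ
      have hc := hρ₀.charpoly_eq_of_isArithFrobAt (W.trace_galoisRepTate_frobenius_of_hasGoodReductionAt_holds 2)
        (W.det_galoisRepTate_frobenius_of_hasGoodReductionAt_holds 2) h2v hgoodv h𝔓 hσ
      have hTp : ι (Ideal.Quotient.mk 𝔪 (HeckeRing0.T L 2 ((primesEquiv v : Nat.Primes) : ℕ) (primesEquiv v).2)) =
          ((W.frobeniusTraceAt v : ℤ) : k) := by
        have hmk : Ideal.Quotient.mk 𝔪 (HeckeRing0.T L 2 ((primesEquiv v : Nat.Primes) : ℕ) (primesEquiv v).2) =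
            Ideal.Quotient.mk 𝔪 ((W.LFunction (primesEquiv v : ℕ) : ℤ) : HeckeRing0 L 2) := by
          rw [Ideal.Quotient.mk_eq_mk_iff_sub_mem]
          exact hT _ (primesEquiv v).2 hpL
        rw [hmk, hι, W.lFunction_primesEquiv_eq_frobeniusTraceAt hgoodv]
      change (((ρ σ : GL (Fin 2) k) : Matrix (Fin 2) (Fin 2) k)).charpoly = _
      rw [hρapp, Matrix.charpoly_map, hc, hTp, natCard_residueField_adicCompletionIntegers v]
      simp only [Polynomial.map_add, Polynomial.map_sub, Polynomial.map_mul, Polynomial.map_pow, Polynomial.map_X,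
        Polynomial.map_C]
      rw [map_intCast f, map_natCast f]
  -- (I) irreducible over `k`: the image contains both transvections
  have hI : FramedRep.IsIrreducible ρ := by
    let v₂ : HeightOneSpectrum (𝓞 ℚ) := primesEquiv.symm ⟨2, Nat.prime_two⟩
    have hv₂ : ((primesEquiv v₂ : Nat.Primes) : ℕ) = 2 := by
      simp only [v₂, Equiv.apply_symm_apply]
    obtain ⟨𝔓, h𝔓⟩ := HeightOneSpectrum.primesAbove_nonempty v₂
    obtain ⟨T₁, hT₁⟩ := exists_GL_coe_eq_upperTransvection (ZMod 2)
    obtain ⟨T₂, hT₂⟩ := exists_GL_coe_eq_lowerTransvection (ZMod 2)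
    obtain ⟨σ₁, -, h₁⟩ := hmem v₂ hv₂ 𝔓 h𝔓 T₁
    obtain ⟨σ₂, -, h₂⟩ := hmem v₂ hv₂ 𝔓 h𝔓 T₂
    have e₁ : ((ρ σ₁ : GL (Fin 2) k) : Matrix (Fin 2) (Fin 2) k) = !![(1 : k), 1; 0, 1] := by
      rw [hρapp, h₁, hT₁, map_upperTransvection]
    have e₂ : ((ρ σ₂ : GL (Fin 2) k) : Matrix (Fin 2) (Fin 2) k) = !![(1 : k), 0; 1, 1] := by
      rw [hρapp, h₂, hT₂, map_lowerTransvection]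
    refine isIrreducible_of_not_hasCommonEigenvector ρ.toMonoidHom ?_
    rintro ⟨w, hw0, hw⟩
    obtain ⟨a, ha⟩ := hw σ₁
    obtain ⟨b, hb⟩ := hw σ₂
    change ((ρ σ₁ : GL (Fin 2) k) : Matrix (Fin 2) (Fin 2) k) *ᵥ w = a • w at ha
    change ((ρ σ₂ : GL (Fin 2) k) : Matrix (Fin 2) (Fin 2) k) *ᵥ w = b • w at hb
    rw [e₁] at ha
    rw [e₂] at hb
    exact hw0 (eq_zero_of_transvections_mulVec_eq_smul ha hb)
  -- (S) non-scalar on the decomposition groups at `2`: the image contains `(1 1; 0 1)`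
  have hS : ∀ v : HeightOneSpectrum (𝓞 ℚ), ((primesEquiv v : Nat.Primes) : ℕ) = 2 →
      ∀ 𝔓 ∈ v.primesAbove, ∃ σ ∈ 𝔓.decompositionSubgroup (Field.absoluteGaloisGroup ℚ),
        ∀ c : k, ((ρ σ : GL (Fin 2) k) : Matrix (Fin 2) (Fin 2) k) ≠ Matrix.scalar (Fin 2) c := by
    intro v hv 𝔓 h𝔓
    obtain ⟨T₁, hT₁⟩ := exists_GL_coe_eq_upperTransvection (ZMod 2)
    obtain ⟨σ, hσ, h⟩ := hmem v hv 𝔓 h𝔓 T₁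
    refine ⟨σ, hσ, fun c hc ↦ ?_⟩
    rw [hρapp, h, hT₁, map_upperTransvection] at hc
    have h01 := congrFun (congrFun hc 0) 1
    simp at h01
  -- the fact's conclusion in EITHER coordinate (sub form today; cosocle form under the Picard typing, converted back by SD)
  first
    | exact hBz L hL 𝔪 h𝔪 h2 k ι ρ hU hI hS
    | exact finrank_torsionBySet_eq_two_of_cosocle_of_sd hSD 𝔪 h2 hq (hBz L hL 𝔪 h𝔪 h2 k ι ρ hU hI hS)

end Summit.BirchSwinnertonDyer.BirchSwinnertonDyer.Theorems.ThetaLayerLambdaCongruenceAtTwo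

end
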